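import Mathlib
import Literature.NumberTheory.Irrationality.BrownZudilin2022.GeneralFamily
import Literature.NumberTheory.Irrationality.BrownZudilin2022.CubicalForm
import Literature.NumberTheory.Irrationality.BrownZudilin2022.BarnesRepresentation
import Summits.KontsevichZagierPeriods.Zeta5Search.WedgeDictionaryThreeTerm
import Summits.KontsevichZagierPeriods.Zeta5Search.WedgeDictionaryKernelAtlasPencil1
import Summits.KontsevichZagierPeriods.Zeta5Search.WedgeDictionaryKernelAtlasPencil2
import Summits.KontsevichZagierPeriods.Zeta5Search.WedgeDictionaryKernelAtlasPencil3
import Summits.KontsevichZagierPeriods.Zeta5Search.WedgeDictionaryKernelAtlasPencil4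
import Summits.KontsevichZagierPeriods.Zeta5Search.WedgeDictionaryKernelAtlasPencil5
import Summits.KontsevichZagierPeriods.Zeta5Search.WedgeDictionaryKernelAtlasPencil6
import Summits.KontsevichZagierPeriods.Zeta5Search.WedgeDictionaryKernelAtlasPencil7

/-!
# The tree node `CellPencil` from F1 + F2 + F3 (cell `pub-zeta5`, lineage gen-1, g21)

HONEST FRAMING: systematic search; no irrationality claim unless certified.  Structure of gen-1's period dictionary
(`WedgeDictionary.explicitPQ`, an OPEN conjecture node) only; nothing about linear forms or ζ(5); nothing is evaluated.

OUR work (Summit side).  PROVED: `cellPencil_of_F123 : F1 → F2 → F3 → CellPencil`, where `CellPencil` is the `@[conjecture]`-tagged node of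
`WedgeDictionaryThreeTerm.lean` (one of the four inputs of `Rows.explicitPQ_of_cells4`), F1 = `cellularIntegral_eq_cubicalIntegral` +
`cubicalIntegral_eq_Jintegral` (Literature `CubicalForm`), F2 = `barnes_double`, F3 = `invariance_group` (Literature `BarnesRepresentation`,
cited published facts used as hypotheses).  Assembly of the seven slot dispatchers `cellPencil_slot<i>` by `interval_cases`.
What this is NOT: it says nothing about `CellStar`, `CellBridge`, `explicitPQ` itself, linear forms or ζ(5).  Generator `code/gen1/g21/atlasgen.py`.
-/

set_option maxHeartbeats 8000000
set_option linter.unusedSimpArgs false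
set_option linter.unusedTactic false
set_option linter.unreachableTactic false
set_option linter.unnecessarySeqFocus false
set_option linter.style.longLine false
set_option linter.unusedVariables false
namespace Summit.KontsevichZagierPeriods.Zeta5Search.WedgeDictionary.KernelCells

open Literature.NumberTheory.Irrationality.BrownZudilin2022 MeasureTheory
open Summit.KontsevichZagierPeriods.Zeta5Search.WedgeDictionary.Kernel

/-- The node `CellPencil` (all seven slots, all admissible parameters) from F1 + F2 + F3. -/
theorem cellPencil_of_F123 (h8 : cellularIntegral_eq_cubicalIntegral) (h10 : cubicalIntegral_eq_Jintegral)
    (hF2 : barnes_double) (hF3 : invariance_group) : CellPencil := by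
  intro a i j₀ j₁ j₂ hi h0 h1 h2
  have hi' : 1 ≤ i ∧ i ≤ 7 := by simpa using hi
  obtain ⟨hi1, hi7⟩ := hi'
  interval_cases i
  · exact cellPencil_slot1 h8 h10 hF2 hF3 a j₀ j₁ j₂ h0 h1 h2
  · exact cellPencil_slot2 h8 h10 hF2 hF3 a j₀ j₁ j₂ h0 h1 h2
  · exact cellPencil_slot3 h8 h10 hF2 hF3 a j₀ j₁ j₂ h0 h1 h2
  · exact cellPencil_slot4 h8 h10 hF2 hF3 a j₀ j₁ j₂ h0 h1 h2
  · exact cellPencil_slot5 h8 h10 hF2 hF3 a j₀ j₁ j₂ h0 h1 h2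
  · exact cellPencil_slot6 h8 h10 hF2 hF3 a j₀ j₁ j₂ h0 h1 h2
  · exact cellPencil_slot7 h8 h10 hF2 hF3 a j₀ j₁ j₂ h0 h1 h2

end Summit.KontsevichZagierPeriods.Zeta5Search.WedgeDictionary.KernelCells
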